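/- Free-seat work of EXTRA WIDTH SEAT `ym-line-cbag-p1-w5` (prover-ym-line-cbag-p1-w5-g3-0), route `EguchiKawaiDirectionLadder`
(ideator ym-idea-2, LINE 8), crux `TripleSmallBallMargin` (stmt-QuantumFields-27724), v7 S10-C prefab: the TRIPLE FIBRE EVENT.  The
outer Weyl / centre-symmetry layer (`ekHaar_symSmallBall_le_of_eigenangle_bound`) hands S10 the first-link fibre
`ekHaar 2 N {W | S_R(D :: W) ≤ t}` of a fixed (diagonal) first link `D`; the one-level decoupling capstone wants a measurable structure
event `E ⊆ U(N) × U(N)` under `Haar ⊗ Haar` together with, ON `E`, the budgets of its `h_block` / `h_rig` hypotheses.  This file: `E` in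
Haar-pair form, its measurability, the three commutator budgets `2Nt` on `E`, and their within-block sub-sums for any block predicate.
Pure bookkeeping, ROUTE-INDEPENDENT.  Nothing here bears on the Yang–Mills mass gap. -/
import Summits.QuantumFields.YangMills.Theorems.EguchiKawaiDirectionLadderFreeTripleOfRigidity
import Summits.QuantumFields.YangMills.Theorems.EguchiKawaiDirectionLadderSingleLinkReductionCore
import Summits.QuantumFields.YangMills.Theorems.EguchiKawaiDirectionLadderPairLawBridge
import Summits.QuantumFields.YangMills.Theorems.EguchiKawaiDirectionLadderBlockPhases
import HarnessLib

/-!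
# Route `EguchiKawaiDirectionLadder`: the triple fibre event in Haar-pair form, with its budgets

For a fixed first link `D ∈ U(N)` and `t : ℝ` put `E_D(t) = {(X,Y) ∈ U(N)² | S_R(![D, X, Y]) ≤ t}`.

* `cons_eq_vecCons` — `Fin.cons D W = ![D, W 0, W 1]`; `ekHaar_two_consFibre_eq_prod` — `ekHaar 2 N {W | S_R(D :: W) ≤ t} = (Haar ⊗ Haar)(E_D(t))`;
  `measurableSet_consFibre` — `E_D(t)` is closed hence measurable;
* `frobSq_comm_le_of_ekAction_three_le` — on `E_D(t)` (and `N > 0`): `‖DX − XD‖_F² ≤ 2Nt`, `‖DY − YD‖_F² ≤ 2Nt`, `‖XY − YX‖_F² ≤ 2Nt`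
  (`S_R` of a triple is the sum of the three pair actions, each `= ‖[·,·]‖_F²/(2N) ≥ 0`);
* `rig_toBlock_le_of_mem`, `comm_toBlock_le_of_mem` — for `D = diagonal d` and ANY block predicate `p`:
  `Σ_{i,j : {p}} |d_i − d_j|²·|(X.toBlock p p)_{ij}|² ≤ 2Nt` (likewise `Y`) and `Σ_{i,j : {p}} |((XY − YX).toBlock p p)_{ij}|² ≤ 2Nt` on `E_D(t)` —
  the `h_rig` / `h_block` budgets of the decoupling capstone, to be instantiated at the pushed pair `(X·ι(V), Y·ι(V′))`.

HONEST FRAMING: bookkeeping only.  The route bears on the barrier-ledger fact `EguchiKawaiBreakdown`; the Yang–Mills mass gap is NOT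
touched.
-/

set_option autoImplicit false

noncomputable section

open MeasureTheory
open scoped Matrix ENNReal
open Literature.Barriers.QuantumFields
open Literature.MathematicalPhysics.QuantumFieldTheory (haarProbability)

namespace Summit.QuantumFields.YangMills.Theorems.EguchiKawaiDirectionLadder

namespace TripleFibre

variable {N : ℕ}

/-! ### §1 The event in Haar-pair form -/

/-- `Fin.cons D W = ![D, W 0, W 1]` for a two-link configuration `W`. -/
theorem cons_eq_vecCons (D : UN N) (W : EKConfig 2 N) : (Fin.cons D W : EKConfig 3 N) = ![D, W 0, W 1] := by
  have h : (![W 0, W 1] : EKConfig 2 N) = W := by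
    funext i
    fin_cases i <;> rfl
  conv_lhs => rw [← h]
  rfl

/-- **The triple fibre in Haar-pair form**: `ekHaar 2 N {W | S_R(D :: W) ≤ t} = (Haar ⊗ Haar){(X,Y) | S_R(![D,X,Y]) ≤ t}`. -/
theorem ekHaar_two_consFibre_eq_prod (D : UN N) (t : ℝ) :
    ekHaar 2 N {W : EKConfig 2 N | ekAction (Fin.cons D W : EKConfig 3 N) ≤ t} =
      ((haarProbability (UN N)).prod (haarProbability (UN N)))
        {p : UN N × UN N | ekAction (![D, p.1, p.2] : EKConfig 3 N) ≤ t} := by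
  have h : {W : EKConfig 2 N | ekAction (Fin.cons D W : EKConfig 3 N) ≤ t} =
      MeasurableEquiv.finTwoArrow (α := UN N) ⁻¹' {p : UN N × UN N | ekAction (![D, p.1, p.2] : EKConfig 3 N) ≤ t} := by
    ext W
    simp only [Set.mem_setOf_eq, Set.mem_preimage, MeasurableEquiv.finTwoArrow_apply, cons_eq_vecCons]
  rw [h, PairLawBridge.ekHaar_two_preimage_eq_prod]

/-- The membership form used by the first-link fibre function: `{W | D :: W ∈ {S_R ≤ t}}` has the same measure. -/
theorem ekHaar_two_consFibre_mem_eq_prod (D : UN N) (t : ℝ) :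
    ekHaar 2 N {W : EKConfig 2 N | (Fin.cons D W : EKConfig 3 N) ∈ {U : EKConfig 3 N | ekAction U ≤ t}} =
      ((haarProbability (UN N)).prod (haarProbability (UN N)))
        {p : UN N × UN N | ekAction (![D, p.1, p.2] : EKConfig 3 N) ≤ t} :=
  ekHaar_two_consFibre_eq_prod D t

/-- The triple fibre event is measurable (closed) in `U(N) × U(N)`. -/
theorem measurableSet_consFibre (D : UN N) (t : ℝ) :
    MeasurableSet {p : UN N × UN N | ekAction (![D, p.1, p.2] : EKConfig 3 N) ≤ t} := by
  refine (isClosed_le ?_ continuous_const).measurableSet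
  refine continuous_ekAction.comp (continuous_pi fun i => ?_)
  fin_cases i
  · simpa using continuous_const
  · simpa using continuous_fst
  · simpa using continuous_snd

/-! ### §2 The three commutator budgets on the event -/

/-- The links of `![D, X, Y]`. -/
theorem vec3_apply (D X Y : UN N) :
    (![D, X, Y] : EKConfig 3 N) 0 = D ∧ (![D, X, Y] : EKConfig 3 N) 1 = X ∧ (![D, X, Y] : EKConfig 3 N) 2 = Y :=
  ⟨rfl, rfl, rfl⟩

/-- `S_R(![D,X,Y]) = S_R(![D,X]) + S_R(![D,Y]) + S_R(![X,Y])`. -/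
theorem ekAction_vec3_eq (D X Y : UN N) :
    ekAction (![D, X, Y] : EKConfig 3 N) =
      ekAction ((![D, X] : EKConfig 2 N)) + ekAction ((![D, Y] : EKConfig 2 N)) + ekAction ((![X, Y] : EKConfig 2 N)) := by
  have h := ekAction_three_eq (![D, X, Y] : EKConfig 3 N)
  obtain ⟨h0, h1, h2⟩ := vec3_apply D X Y
  rw [h0, h1, h2] at h
  exact h

/-- A pair action bounded by `t` bounds the commutator: `S_R(![A,B]) ≤ t ⇒ ‖AB − BA‖_F² ≤ 2Nt` (`N > 0`). -/
theorem frobSq_comm_le_of_ekAction_pair_le (hN : 0 < N) {A B : UN N} {t : ℝ}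
    (h : ekAction ((![A, B] : EKConfig 2 N)) ≤ t) :
    frobSq ((A : Matrix (Fin N) (Fin N) ℂ) * (B : Matrix (Fin N) (Fin N) ℂ) -
        (B : Matrix (Fin N) (Fin N) ℂ) * (A : Matrix (Fin N) (Fin N) ℂ)) ≤ 2 * N * t := by
  rw [ekAction_pair_eq_frobSq hN] at h
  have hN' : (0 : ℝ) < 2 * N := by positivity
  rw [div_le_iff₀ hN'] at h
  linarith

/-- **The three budgets on the triple fibre event** (`N > 0`): `S_R(![D,X,Y]) ≤ t` gives
`‖DX − XD‖_F² ≤ 2Nt`, `‖DY − YD‖_F² ≤ 2Nt`, `‖XY − YX‖_F² ≤ 2Nt`. -/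
theorem frobSq_comm_le_of_ekAction_three_le (hN : 0 < N) {D X Y : UN N} {t : ℝ}
    (h : ekAction (![D, X, Y] : EKConfig 3 N) ≤ t) :
    frobSq ((D : Matrix (Fin N) (Fin N) ℂ) * (X : Matrix (Fin N) (Fin N) ℂ) -
        (X : Matrix (Fin N) (Fin N) ℂ) * (D : Matrix (Fin N) (Fin N) ℂ)) ≤ 2 * N * t ∧
      frobSq ((D : Matrix (Fin N) (Fin N) ℂ) * (Y : Matrix (Fin N) (Fin N) ℂ) -
        (Y : Matrix (Fin N) (Fin N) ℂ) * (D : Matrix (Fin N) (Fin N) ℂ)) ≤ 2 * N * t ∧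
      frobSq ((X : Matrix (Fin N) (Fin N) ℂ) * (Y : Matrix (Fin N) (Fin N) ℂ) -
        (Y : Matrix (Fin N) (Fin N) ℂ) * (X : Matrix (Fin N) (Fin N) ℂ)) ≤ 2 * N * t := by
  rw [ekAction_vec3_eq] at h
  have h1 := ekAction_nonneg ((![D, X] : EKConfig 2 N))
  have h2 := ekAction_nonneg ((![D, Y] : EKConfig 2 N))
  have h3 := ekAction_nonneg ((![X, Y] : EKConfig 2 N))
  exact ⟨frobSq_comm_le_of_ekAction_pair_le hN (by linarith),
    frobSq_comm_le_of_ekAction_pair_le hN (by linarith),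
    frobSq_comm_le_of_ekAction_pair_le hN (by linarith)⟩

/-! ### §3 Within-block sub-sums of the budgets (the `h_rig` / `h_block` inputs) -/

/-- A weighted rigidity sum over a block is at most `‖diag(d)X − X diag(d)‖_F²`. -/
theorem rig_toBlock_le_frobSq (d : Fin N → ℂ) (X : Matrix (Fin N) (Fin N) ℂ) (p : Fin N → Prop) [DecidablePred p] :
    ∑ i : {i // p i}, ∑ j : {i // p i}, ‖d i - d j‖ ^ 2 * ‖X.toBlock p p i j‖ ^ 2 ≤
      frobSq (Matrix.diagonal d * X - X * Matrix.diagonal d) := by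
  rw [frobSq_diagonal_comm]
  exact BlockPhases.sum_sum_weight_toBlock_le p d X

/-- A Frobenius sum over a block is at most the full Frobenius sum. -/
theorem toBlock_le_frobSq (M : Matrix (Fin N) (Fin N) ℂ) (p : Fin N → Prop) [DecidablePred p] :
    ∑ i : {i // p i}, ∑ j : {i // p i}, ‖M.toBlock p p i j‖ ^ 2 ≤ frobSq M :=
  BlockPhases.sum_sum_subtype_le p (fun i j => ‖M i j‖ ^ 2) fun i j => by positivity

/-- **`h_rig` budgets**: on the triple fibre event of a DIAGONAL first link `D = diagonal d`, for every block predicate `p`,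
`Σ_{i,j : {p}} |d_i − d_j|²·|(X.toBlock p p)_{ij}|² ≤ 2Nt` and the same for `Y`. -/
theorem rig_toBlock_le_of_mem (hN : 0 < N) {D X Y : UN N} {d : Fin N → ℂ}
    (hD : (D : Matrix (Fin N) (Fin N) ℂ) = Matrix.diagonal d) {t : ℝ} (h : ekAction (![D, X, Y] : EKConfig 3 N) ≤ t)
    (p : Fin N → Prop) [DecidablePred p] :
    ∑ i : {i // p i}, ∑ j : {i // p i}, ‖d i - d j‖ ^ 2 * ‖(X : Matrix (Fin N) (Fin N) ℂ).toBlock p p i j‖ ^ 2 ≤ 2 * N * t ∧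
      ∑ i : {i // p i}, ∑ j : {i // p i}, ‖d i - d j‖ ^ 2 * ‖(Y : Matrix (Fin N) (Fin N) ℂ).toBlock p p i j‖ ^ 2 ≤ 2 * N * t := by
  obtain ⟨hX, hY, -⟩ := frobSq_comm_le_of_ekAction_three_le hN h
  rw [hD] at hX hY
  exact ⟨(rig_toBlock_le_frobSq d _ p).trans hX, (rig_toBlock_le_frobSq d _ p).trans hY⟩

/-- **`h_block` budget**: on the triple fibre event, for every block predicate `p`,
`Σ_{i,j : {p}} |((XY − YX).toBlock p p)_{ij}|² ≤ 2Nt`. -/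
theorem comm_toBlock_le_of_mem (hN : 0 < N) {D X Y : UN N} {t : ℝ} (h : ekAction (![D, X, Y] : EKConfig 3 N) ≤ t)
    (p : Fin N → Prop) [DecidablePred p] :
    ∑ i : {i // p i}, ∑ j : {i // p i},
        ‖((X : Matrix (Fin N) (Fin N) ℂ) * (Y : Matrix (Fin N) (Fin N) ℂ) -
          (Y : Matrix (Fin N) (Fin N) ℂ) * (X : Matrix (Fin N) (Fin N) ℂ)).toBlock p p i j‖ ^ 2 ≤ 2 * N * t := by
  obtain ⟨-, -, hXY⟩ := frobSq_comm_le_of_ekAction_three_le hN h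
  exact (toBlock_le_frobSq _ p).trans hXY

/-- The first-link budget alone: on the event, `‖DX − XD‖_F² ≤ 2Nt` written with `D = diagonal d` (the off-block input `E ⇒ A`). -/
theorem frobSq_diagonal_comm_le_of_mem (hN : 0 < N) {D X Y : UN N} {d : Fin N → ℂ}
    (hD : (D : Matrix (Fin N) (Fin N) ℂ) = Matrix.diagonal d) {t : ℝ} (h : ekAction (![D, X, Y] : EKConfig 3 N) ≤ t) :
    frobSq (Matrix.diagonal d * (X : Matrix (Fin N) (Fin N) ℂ) - (X : Matrix (Fin N) (Fin N) ℂ) * Matrix.diagonal d) ≤ 2 * N * t ∧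
      frobSq (Matrix.diagonal d * (Y : Matrix (Fin N) (Fin N) ℂ) - (Y : Matrix (Fin N) (Fin N) ℂ) * Matrix.diagonal d) ≤ 2 * N * t := by
  obtain ⟨hX, hY, -⟩ := frobSq_comm_le_of_ekAction_three_le hN h
  rw [hD] at hX hY
  exact ⟨hX, hY⟩

end TripleFibre

end Summit.QuantumFields.YangMills.Theorems.EguchiKawaiDirectionLadder

end
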